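import Mathlib
import Literature.Probability.Percolation.DiagonalStripTransferInsertion
import Literature.Probability.Percolation.DiagonalStripSmallLinkPatterns
import HarnessLib

/-!
# Inserting a site into a column of the diagonal strip: the column update

Topic `Literature/Probability/Percolation`. The combinatorial heart of Ikhlef–Ponsaing
(J. Stat. Phys. 149 (2012), arXiv:1202.5476) **Lemma 3.3** in the cluster language: how the
deterministic column update `colUpdate` of `DiagonalColumnPatterns.lean` behaves when the source
column pattern is a small-link insertion (`cpInsIso a Q`: a singleton site inserted at `a`;
`cpInsDup j₀ Q`: the site `j₀` duplicated — `DiagonalStripSmallLinkPatterns.lean`).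

* **`colUpdate_cpInsIso_open`** — inserted singleton source `a`, both lattice edges at `a` open: the
  update is `cpInsDup j₀` of the small update (the two new target sites hang on `a` only);
* **`colUpdate_cpInsIso_leaf`** — inserted singleton source, at most one edge at `a` open: the same
  update as with both closed (a flagless singleton hanging on one edge is invisible);
* **`colUpdate_cpInsDup_closed`** — duplicated source `j₀`, both edges into the new target `a`
  closed: the update is `cpInsIso a` of the small update;
* **`colUpdate_cpInsDup_open_eq`** — duplicated source, at least one edge into `a` open: the three
  updates coincide (the two copies are joined, so it does not matter which edge is used).

Together with the fusion identities of `DiagonalStripTransferFusion.lean` (the distinguished edge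
pattern has weight `1`, the other three total weight `0`) this gives Lemma 3.3
(`DiagonalStripTransferRecursion.lean`).

## References

* Y. Ikhlef, A. K. Ponsaing, *Finite-size left-passage probability in percolation*, J. Stat. Phys.
  149 (2012) 10–36, arXiv:1202.5476, Lemma 3.3. [IkhlefPonsaing2012]
-/

namespace Literature.Probability.Percolation

open Finset Literature.Probability.LatticeModels Literature.Probability.LatticeModels.TemperleyLieb

/-! ### Inserting a source site: the update -/

section InsSrcUpdate

variable {n : ℕ}

/-- The relation of `cpInsIso`, in `Prop`. [folklore] -/
theorem cpInsIso_fst_iff (a : Fin (n + 2)) (Q : ColPattern n) (x y : Fin (n + 2)) :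
    (cpInsIso a Q).1 x y = true ↔ x = y ∨ ∃ x' y', a.succAbove x' = x ∧ a.succAbove y' = y ∧ Q.1 x' y' = true := by
  show SiteRel.insertIso Q.1 a x y = true ↔ _
  unfold SiteRel.insertIso
  simp only [Bool.or_eq_true, decide_eq_true_eq]

/-- The flags of `cpInsIso`, in `Prop`. [folklore] -/
theorem cpInsIso_snd_iff (a : Fin (n + 2)) (Q : ColPattern n) (x : Fin (n + 2)) :
    (cpInsIso a Q).2 x = true ↔ ∃ x', a.succAbove x' = x ∧ Q.2 x' = true := by
  show decide _ = true ↔ _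
  rw [decide_eq_true_eq]

/-- The relation of `cpInsDup`. [folklore] -/
@[simp] theorem cpInsDup_fst (j : Fin (n + 1)) (Q : ColPattern n) (x y : Fin (n + 2)) :
    (cpInsDup j Q).1 x y = Q.1 (j.predAbove x) (j.predAbove y) := rfl

/-- The flags of `cpInsDup`. [folklore] -/
@[simp] theorem cpInsDup_snd (j : Fin (n + 1)) (Q : ColPattern n) (x : Fin (n + 2)) :
    (cpInsDup j Q).2 x = Q.2 (j.predAbove x) := rfl

/-- **Inserted singleton source, both new edges open: the update is the duplicated old update.**
With the source site `a` inserted as a singleton into `Q` and both lattice edges at `a` open, the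
new column's pattern is the old update with the site `j₀` duplicated. [cite: IkhlefPonsaing2012, Lemma 3.3] -/
theorem colUpdate_cpInsIso_open (c : ℤ) (a : Fin (n + 2)) (j₀ : Fin (n + 1))
    (haj : (c % 2 = 0 ∧ (a : ℕ) = j₀ + 1) ∨ (c % 2 = 1 ∧ (a : ℕ) = j₀)) (Q : ColPattern n)
    {I : Finset (Fin (n + 1) × Fin (n + 1))} (hI : I ⊆ latticeIdx n c) :
    colUpdate (n + 1) c (cpInsIso a Q)
        (idxEdgeFn (insert (a, j₀.castSucc) (insert (a, j₀.succ) (I.image (insSrcIdx a))))) =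
      cpInsDup j₀ (colUpdate n c Q (idxEdgeFn I)) := by
  classical
  set E' := idxEdgeFn (insert (a, j₀.castSucc) (insert (a, j₀.succ) (I.image (insSrcIdx a)))) with hE'
  set E := idxEdgeFn I with hE
  -- the comparison map from big nodes to small nodes
  let π : Fin (n + 2) ⊕ Fin (n + 2) → Fin (n + 1) ⊕ Fin (n + 1) := fun x => match x with
    | Sum.inl i' => if i' = a then Sum.inr j₀ else Sum.inl (unshift a i')
    | Sum.inr j' => Sum.inr (j₀.predAbove j')
  have hπa : π (Sum.inl a) = Sum.inr j₀ := by simp [π]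
  have hπsucc : ∀ i, π (Sum.inl (a.succAbove i)) = Sum.inl i := by
    intro i; simp [π, Fin.succAbove_ne]
  have hπr : ∀ j', π (Sum.inr j') = Sum.inr (j₀.predAbove j') := fun _ => rfl
  have hE'iff : ∀ i' j', E' i' j' = true ↔
      (i' = a ∧ (j' = j₀.castSucc ∨ j' = j₀.succ)) ∨ ∃ p ∈ I, insSrcIdx a p = (i', j') := by
    intro i' j'
    simp only [hE', idxEdgeFn_apply, Finset.mem_insert, Finset.mem_image, Prod.mk.injEq, decide_eq_true_eq]
    tauto
  have hnew : ∀ j', j' = j₀.castSucc ∨ j' = j₀.succ →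
      Relation.EqvGen (updRel (n + 1) (cpInsIso a Q) E') (Sum.inl a) (Sum.inr j') := fun j' hj' =>
    Relation.EqvGen.rel _ _ ((updRel_inl_inr _ _ _ _).2 ((hE'iff _ _).2 (Or.inl ⟨rfl, hj'⟩)))
  have key : ∀ x y, Relation.EqvGen (updRel (n + 1) (cpInsIso a Q) E') x y ↔
      Relation.EqvGen (updRel n Q E) (π x) (π y) := by
    apply eqvGen_map_iff π
    · -- generators map into the closure
      rintro (i' | j') (i'' | j'') h
      · rcases (cpInsIso_fst_iff a Q i' i'').1 h with rfl | ⟨x', y', rfl, rfl, hQ⟩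
        · exact Relation.EqvGen.refl _
        · rw [hπsucc, hπsucc]; exact Relation.EqvGen.rel _ _ hQ
      · rcases (hE'iff i' j'').1 h with ⟨rfl, hj⟩ | ⟨⟨i, j⟩, hpI, hp⟩
        · rw [hπa, hπr, (predAbove_eq_self_iff j₀ j'').2 hj]; exact Relation.EqvGen.refl _
        · have h1 : i' = a.succAbove i := (congrArg Prod.fst hp).symm
          have h2 : j'' = (insSrcIdx a (i, j)).2 := (congrArg Prod.snd hp).symm
          rw [h1, h2, hπsucc, hπr, predAbove_insSrcIdx_snd c a j₀ haj (hI hpI)]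
          exact Relation.EqvGen.rel _ _ (by simpa [hE] using hpI)
      · rcases (hE'iff i'' j').1 h with ⟨rfl, hj⟩ | ⟨⟨i, j⟩, hpI, hp⟩
        · rw [hπa, hπr, (predAbove_eq_self_iff j₀ j').2 hj]; exact Relation.EqvGen.refl _
        · have h1 : i'' = a.succAbove i := (congrArg Prod.fst hp).symm
          have h2 : j' = (insSrcIdx a (i, j)).2 := (congrArg Prod.snd hp).symm
          rw [h1, h2, hπsucc, hπr, predAbove_insSrcIdx_snd c a j₀ haj (hI hpI)]
          exact Relation.EqvGen.rel _ _ (by simpa [hE] using hpI)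
      · exact absurd h (updRel_inr_inr _ _ _ _)
    · -- generators lift
      rintro (i | j) (i₂ | j₂) h
      · refine ⟨Sum.inl (a.succAbove i), Sum.inl (a.succAbove i₂), hπsucc i, hπsucc i₂,
          Relation.EqvGen.rel _ _ ?_⟩
        rw [updRel_inl_inl, cpInsIso_fst_iff]
        exact Or.inr ⟨i, i₂, rfl, rfl, h⟩
      · have hpI : (i, j₂) ∈ I := by simpa [hE] using h
        refine ⟨Sum.inl (insSrcIdx a (i, j₂)).1, Sum.inr (insSrcIdx a (i, j₂)).2, hπsucc i, ?_,
          Relation.EqvGen.rel _ _ ?_⟩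
        · rw [hπr, predAbove_insSrcIdx_snd c a j₀ haj (hI hpI)]
        · rw [updRel_inl_inr, hE'iff]; exact Or.inr ⟨(i, j₂), hpI, rfl⟩
      · have hpI : (i₂, j) ∈ I := by simpa [hE] using h
        refine ⟨Sum.inr (insSrcIdx a (i₂, j)).2, Sum.inl (insSrcIdx a (i₂, j)).1, ?_, hπsucc i₂,
          Relation.EqvGen.rel _ _ ?_⟩
        · rw [hπr, predAbove_insSrcIdx_snd c a j₀ haj (hI hpI)]
        · rw [updRel_inr_inl, hE'iff]; exact Or.inr ⟨(i₂, j), hpI, rfl⟩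
      · exact absurd h (updRel_inr_inr _ _ _ _)
    · -- fibres are connected
      rintro (i' | j') (i'' | j'') h
      · by_cases h1 : i' = a <;> by_cases h2 : i'' = a
        · rw [h1, h2]; exact Relation.EqvGen.refl _
        · simp [π, h1, h2] at h
        · simp [π, h1, h2] at h
        · simp only [π, h1, h2, if_false, Sum.inl.injEq] at h
          rw [← succAbove_unshift h1, ← succAbove_unshift h2, h]
          exact Relation.EqvGen.refl _
      · by_cases h1 : i' = a
        · rw [h1] at h ⊢
          rw [hπa, hπr, Sum.inr.injEq, eq_comm, predAbove_eq_self_iff] at h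
          exact hnew j'' h
        · simp [π, h1] at h
      · by_cases h2 : i'' = a
        · rw [h2] at h ⊢
          rw [hπa, hπr, Sum.inr.injEq, predAbove_eq_self_iff] at h
          exact Relation.EqvGen.symm _ _ (hnew j' h)
        · simp [π, h2] at h
      · rw [hπr, hπr, Sum.inr.injEq, predAbove_eq_predAbove_iff] at h
        rcases h with rfl | ⟨rfl, rfl⟩ | ⟨rfl, rfl⟩
        · exact Relation.EqvGen.refl _
        · exact Relation.EqvGen.trans _ _ _ (Relation.EqvGen.symm _ _ (hnew _ (Or.inl rfl))) (hnew _ (Or.inr rfl))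
        · exact Relation.EqvGen.trans _ _ _ (Relation.EqvGen.symm _ _ (hnew _ (Or.inr rfl))) (hnew _ (Or.inl rfl))
  -- read off the two components
  refine Prod.ext (funext fun j' => funext fun j'' => ?_) (funext fun j' => ?_)
  · rw [Bool.eq_iff_iff, colUpdate_fst_iff, key, hπr, hπr, cpInsDup_fst, colUpdate_fst_iff]
  · rw [Bool.eq_iff_iff, colUpdate_snd_iff, cpInsDup_snd, colUpdate_snd_iff]
    constructor
    · rintro ⟨z, hz, hw⟩
      rw [key, hπr] at hz
      refine ⟨π z, hz, ?_⟩
      rcases z with i' | j''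
      · rw [updWall_inl, cpInsIso_snd_iff] at hw
        obtain ⟨x', rfl, hx'⟩ := hw
        rw [hπsucc]; exact hx'
      · rw [updWall_inr] at hw ⊢
        obtain ⟨hw1, hw2⟩ := hw
        refine ⟨hw1, ?_⟩
        rw [val_predAbove, hw2]; split_ifs <;> omega
    · rintro ⟨z, hz, hw⟩
      rcases z with i | j
      · refine ⟨Sum.inl (a.succAbove i), ?_, ?_⟩
        · rw [key, hπr, hπsucc]; exact hz
        · rw [updWall_inl, cpInsIso_snd_iff]; exact ⟨i, rfl, hw⟩
      · rw [updWall_inr] at hw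
        obtain ⟨hw1, hw2⟩ := hw
        have hj0 : j = 0 := Fin.ext hw2
        subst hj0
        refine ⟨Sum.inr 0, ?_, ?_⟩
        · rw [key, hπr, hπr, Fin.predAbove_right_zero]; exact hz
        · rw [updWall_inr]; exact ⟨hw1, rfl⟩

/-- **Inserted singleton source, one new edge: nothing changes.** [cite: IkhlefPonsaing2012, Lemma 3.3] -/
theorem colUpdate_cpInsIso_leaf (c : ℤ) (a t : Fin (n + 2)) (Q : ColPattern n)
    (J : Finset (Fin (n + 2) × Fin (n + 2))) (hJ : ∀ p ∈ J, p.1 ≠ a) :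
    colUpdate (n + 1) c (cpInsIso a Q) (idxEdgeFn (insert (a, t) J)) =
      colUpdate (n + 1) c (cpInsIso a Q) (idxEdgeFn J) := by
  classical
  refine colUpdate_add_leaf c (cpInsIso a Q) a t (fun i h => ?_) (fun i h => ?_) ?_ (fun j => ?_)
    (fun i j => ?_)
  · have h' : SiteRel.insertIso Q.1 a a i = true := h
    rw [SiteRel.insertIso_self_left, decide_eq_true_eq] at h'
    exact h'.symm
  · have h' : SiteRel.insertIso Q.1 a i a = true := h
    rw [SiteRel.insertIso_self_right, decide_eq_true_eq] at h'
    exact h'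
  · rw [← Bool.not_eq_true, cpInsIso_snd_iff]
    rintro ⟨x', hx', -⟩
    exact Fin.succAbove_ne a x' hx'
  · rw [idxEdgeFn_apply, decide_eq_false_iff_not]
    exact fun h => hJ _ h rfl
  · simp only [idxEdgeFn_apply, Finset.mem_insert, Prod.mk.injEq, decide_eq_true_eq]
    tauto

end InsSrcUpdate

/-! ### Inserting a target site: the update -/

section InsTgtUpdate

variable {n : ℕ}

/-- **Duplicated source, both new edges closed: the update is the old update with the new target
inserted as a singleton.** [cite: IkhlefPonsaing2012, Lemma 3.3] -/
theorem colUpdate_cpInsDup_closed (c : ℤ) (a : Fin (n + 2)) (j₀ : Fin (n + 1))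
    (haj : (c % 2 = 0 ∧ (a : ℕ) = j₀) ∨ (c % 2 = 1 ∧ (a : ℕ) = j₀ + 1))
    {Q : ColPattern n} (hQ : Q.1 j₀ j₀ = true) {I : Finset (Fin (n + 1) × Fin (n + 1))}
    (hI : I ⊆ latticeIdx n c) :
    colUpdate (n + 1) c (cpInsDup j₀ Q) (idxEdgeFn (I.image (insTgtIdx a))) =
      cpInsIso a (colUpdate n c Q (idxEdgeFn I)) := by
  classical
  set E' := idxEdgeFn (I.image (insTgtIdx a)) with hE'
  set E := idxEdgeFn I with hE
  set R' := updRel (n + 1) (cpInsDup j₀ Q) E' with hR'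
  have hE'iff : ∀ i' j', E' i' j' = true ↔ ∃ p ∈ I, insTgtIdx a p = (i', j') := by
    intro i' j'; simp [hE']
  -- the new target `a` is isolated
  have hE'a : ∀ i, E' i a = false := by
    intro i
    rw [← Bool.not_eq_true, hE'iff]
    rintro ⟨p, -, hp⟩
    exact insTgtIdx_snd_ne a p (congrArg Prod.snd hp)
  have hiso : ∀ y, ¬ R' (Sum.inr a) y ∧ ¬ R' y (Sum.inr a) := by
    rintro (i | j)
    · simp [hR', hE'a]
    · simp [hR']
  have hisoIff : ∀ y, Relation.EqvGen R' (Sum.inr a) y ↔ y = Sum.inr a := eqvGen_isolated_iff hiso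
  -- step 1: remove the isolated node
  let φ : Fin (n + 2) ⊕ Fin (n + 1) → Fin (n + 2) ⊕ Fin (n + 2) := Sum.map id a.succAbove
  have hφl : ∀ i, φ (Sum.inl i) = Sum.inl i := fun _ => rfl
  have hφr : ∀ j, φ (Sum.inr j) = Sum.inr (a.succAbove j) := fun _ => rfl
  have hφinj : Function.Injective φ :=
    Sum.map_injective.2 ⟨Function.injective_id, Fin.succAbove_right_injective⟩
  set Rm : Fin (n + 2) ⊕ Fin (n + 1) → Fin (n + 2) ⊕ Fin (n + 1) → Prop := fun x y => R' (φ x) (φ y)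
    with hRm
  have step1 : ∀ x y, Relation.EqvGen R' (φ x) (φ y) ↔ Relation.EqvGen Rm x y := by
    intro x y
    apply eqvGen_iff_of_injective φ hφinj (fun _ _ => Iff.rfl)
    rintro (i' | j') (i'' | j'') h
    · exact ⟨⟨Sum.inl i', rfl⟩, ⟨Sum.inl i'', rfl⟩⟩
    · obtain ⟨p, -, hp⟩ := (hE'iff _ _).1 h
      have h2 : (insTgtIdx a p).2 = j'' := congrArg Prod.snd hp
      refine ⟨⟨Sum.inl i', rfl⟩, ⟨Sum.inr p.2, ?_⟩⟩
      rw [hφr, ← h2, insTgtIdx_snd]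
    · obtain ⟨p, -, hp⟩ := (hE'iff _ _).1 h
      have h2 : (insTgtIdx a p).2 = j' := congrArg Prod.snd hp
      refine ⟨⟨Sum.inr p.2, ?_⟩, ⟨Sum.inl i'', rfl⟩⟩
      rw [hφr, ← h2, insTgtIdx_snd]
    · exact absurd h (updRel_inr_inr _ _ _ _)
  -- step 2: contract the duplicated source
  let π : Fin (n + 2) ⊕ Fin (n + 1) → Fin (n + 1) ⊕ Fin (n + 1) := Sum.map j₀.predAbove id
  have hπl : ∀ i, π (Sum.inl i) = Sum.inl (j₀.predAbove i) := fun _ => rfl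
  have hπr : ∀ j, π (Sum.inr j) = Sum.inr j := fun _ => rfl
  have hRm_ll : ∀ x y, Rm (Sum.inl x) (Sum.inl y) ↔ Q.1 (j₀.predAbove x) (j₀.predAbove y) = true :=
    fun _ _ => Iff.rfl
  have hRm_lr : ∀ x j, Rm (Sum.inl x) (Sum.inr j) ↔ E' x (a.succAbove j) = true := fun _ _ => Iff.rfl
  have hRm_rl : ∀ x j, Rm (Sum.inr j) (Sum.inl x) ↔ E' x (a.succAbove j) = true := fun _ _ => Iff.rfl
  have hRm_rr : ∀ j j', ¬ Rm (Sum.inr j) (Sum.inr j') := fun _ _ h => h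
  have hdup : ∀ x y, (x = j₀.castSucc ∧ y = j₀.succ) ∨ (x = j₀.succ ∧ y = j₀.castSucc) →
      Relation.EqvGen Rm (Sum.inl x) (Sum.inl y) := by
    rintro x y (⟨rfl, rfl⟩ | ⟨rfl, rfl⟩) <;> refine Relation.EqvGen.rel _ _ ?_ <;>
      rw [hRm_ll, predAbove_castSucc_self', predAbove_succ_self'] <;> exact hQ
  have step2 : ∀ x y, Relation.EqvGen Rm x y ↔ Relation.EqvGen (updRel n Q E) (π x) (π y) := by
    apply eqvGen_map_iff π
    · rintro (i' | j) (i'' | j₂) h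
      · rw [hπl, hπl]
        rw [hRm_ll] at h
        exact Relation.EqvGen.rel _ _ h
      · rw [hRm_lr] at h
        obtain ⟨⟨i₀, j₁⟩, hpI, hp⟩ := (hE'iff _ _).1 h
        have h1 : (insTgtIdx a (i₀, j₁)).1 = i' := congrArg Prod.fst hp
        have h2 : (insTgtIdx a (i₀, j₁)).2 = a.succAbove j₂ := congrArg Prod.snd hp
        have hj : j₁ = j₂ := Fin.succAbove_right_injective h2
        subst hj
        have hi : j₀.predAbove i' = i₀ := by
          rw [← h1]; exact predAbove_insTgtIdx_fst c a j₀ haj (hI hpI)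
        rw [hπl, hπr, hi]
        exact Relation.EqvGen.rel _ _ (by simpa [hE] using hpI)
      · rw [hRm_rl] at h
        obtain ⟨⟨i₀, j₁⟩, hpI, hp⟩ := (hE'iff _ _).1 h
        have h1 : (insTgtIdx a (i₀, j₁)).1 = i'' := congrArg Prod.fst hp
        have h2 : (insTgtIdx a (i₀, j₁)).2 = a.succAbove j := congrArg Prod.snd hp
        have hj : j₁ = j := Fin.succAbove_right_injective h2
        subst hj
        have hi : j₀.predAbove i'' = i₀ := by
          rw [← h1]; exact predAbove_insTgtIdx_fst c a j₀ haj (hI hpI)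
        rw [hπl, hπr, hi]
        exact Relation.EqvGen.rel _ _ (by simpa [hE] using hpI)
      · exact absurd h (hRm_rr _ _)
    · rintro (i | j) (i₂ | j₂) h
      · refine ⟨Sum.inl ((Fin.castSucc j₀).succAbove i), Sum.inl ((Fin.castSucc j₀).succAbove i₂), ?_, ?_,
          Relation.EqvGen.rel _ _ ?_⟩
        · rw [hπl, Fin.predAbove_succAbove]
        · rw [hπl, Fin.predAbove_succAbove]
        · rw [hRm_ll, Fin.predAbove_succAbove, Fin.predAbove_succAbove]; exact h
      · have hpI : (i, j₂) ∈ I := by simpa [hE] using h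
        refine ⟨Sum.inl (insTgtIdx a (i, j₂)).1, Sum.inr j₂, ?_, rfl, Relation.EqvGen.rel _ _ ?_⟩
        · rw [hπl, predAbove_insTgtIdx_fst c a j₀ haj (hI hpI)]
        · rw [hRm_lr, hE'iff]; exact ⟨(i, j₂), hpI, rfl⟩
      · have hpI : (i₂, j) ∈ I := by simpa [hE] using h
        refine ⟨Sum.inr j, Sum.inl (insTgtIdx a (i₂, j)).1, rfl, ?_, Relation.EqvGen.rel _ _ ?_⟩
        · rw [hπl, predAbove_insTgtIdx_fst c a j₀ haj (hI hpI)]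
        · rw [hRm_rl, hE'iff]; exact ⟨(i₂, j), hpI, rfl⟩
      · exact absurd h (updRel_inr_inr _ _ _ _)
    · rintro (i' | j) (i'' | j₂) h
      · rw [hπl, hπl, Sum.inl.injEq, predAbove_eq_predAbove_iff] at h
        rcases h with rfl | h
        · exact Relation.EqvGen.refl _
        · exact hdup _ _ h
      · simp [hπl, hπr] at h
      · simp [hπl, hπr] at h
      · rw [hπr, hπr, Sum.inr.injEq] at h
        rw [h]; exact Relation.EqvGen.refl _
  have key : ∀ x y, Relation.EqvGen R' (φ x) (φ y) ↔ Relation.EqvGen (updRel n Q E) (π x) (π y) :=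
    fun x y => (step1 x y).trans (step2 x y)
  -- read off the two components
  refine Prod.ext (funext fun j' => funext fun j'' => ?_) (funext fun j' => ?_)
  · rw [Bool.eq_iff_iff, colUpdate_fst_iff, cpInsIso_fst_iff]
    simp only [colUpdate_fst_iff]
    by_cases h' : j' = a
    · subst h'
      rw [hisoIff, Sum.inr.injEq]
      constructor
      · rintro rfl; exact Or.inl rfl
      · rintro (rfl | ⟨x', y', hx', -, -⟩)
        · rfl
        · exact absurd hx' (Fin.succAbove_ne _ _)
    · obtain ⟨u, rfl⟩ := Fin.exists_succAbove_eq h'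
      by_cases h'' : j'' = a
      · subst h''
        constructor
        · intro h
          have := (hisoIff _).1 (Relation.EqvGen.symm _ _ h)
          rw [Sum.inr.injEq] at this
          exact absurd this (Fin.succAbove_ne _ _)
        · rintro (h | ⟨x', y', -, hy', -⟩)
          · exact absurd h (Fin.succAbove_ne _ _)
          · exact absurd hy' (Fin.succAbove_ne _ _)
      · obtain ⟨v, rfl⟩ := Fin.exists_succAbove_eq h''
        have hk := key (Sum.inr u) (Sum.inr v)
        rw [hφr, hφr, hπr, hπr] at hk
        rw [hk]
        constructor
        · intro h; exact Or.inr ⟨u, v, rfl, rfl, h⟩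
        · rintro (h | ⟨x', y', hx', hy', h⟩)
          · rw [Fin.succAbove_right_inj] at h
            rw [h]; exact Relation.EqvGen.refl _
          · rw [Fin.succAbove_right_inj] at hx' hy'
            subst hx'; subst hy'; exact h
  · rw [Bool.eq_iff_iff, colUpdate_snd_iff, cpInsIso_snd_iff]
    simp only [colUpdate_snd_iff]
    by_cases h' : j' = a
    · subst h'
      constructor
      · rintro ⟨z, hz, hw⟩
        rw [hisoIff] at hz
        subst hz
        rw [updWall_inr] at hw
        exfalso
        rcases haj with ⟨hc, ha⟩ | ⟨hc, ha⟩ <;> omega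
      · rintro ⟨x', hx', -⟩
        exact absurd hx' (Fin.succAbove_ne _ _)
    · obtain ⟨u, rfl⟩ := Fin.exists_succAbove_eq h'
      constructor
      · rintro ⟨z, hz, hw⟩
        refine ⟨u, rfl, ?_⟩
        have hz' : z ≠ Sum.inr a := by
          rintro rfl
          have := (hisoIff _).1 (Relation.EqvGen.symm _ _ hz)
          rw [Sum.inr.injEq] at this
          exact Fin.succAbove_ne a u this
        obtain ⟨zm, rfl⟩ : ∃ zm, φ zm = z := by
          rcases z with i' | j''
          · exact ⟨Sum.inl i', rfl⟩
          · have hj'' : j'' ≠ a := fun h => hz' (by rw [h])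
            obtain ⟨v, rfl⟩ := Fin.exists_succAbove_eq hj''
            exact ⟨Sum.inr v, rfl⟩
        refine ⟨π zm, (key (Sum.inr u) zm).1 hz, ?_⟩
        rcases zm with i' | v
        · rw [hπl, updWall_inl]
          rw [hφl, updWall_inl, cpInsDup_snd] at hw
          exact hw
        · rw [hπr, updWall_inr]
          rw [hφr, updWall_inr, val_succAbove] at hw
          obtain ⟨hw1, hw2⟩ := hw
          refine ⟨hw1, ?_⟩
          have := a.2
          rcases haj with ⟨hc, ha⟩ | ⟨hc, ha⟩ <;> split_ifs at hw2 <;> omega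
      · rintro ⟨x', hx', z, hz, hw⟩
        rw [Fin.succAbove_right_inj] at hx'
        subst hx'
        rcases z with i | j
        · refine ⟨Sum.inl ((Fin.castSucc j₀).succAbove i), ?_, ?_⟩
          · have hk := key (Sum.inr x') (Sum.inl ((Fin.castSucc j₀).succAbove i))
            rw [hφr, hφl, hπr, hπl, Fin.predAbove_succAbove] at hk
            exact hk.2 hz
          · rw [updWall_inl, cpInsDup_snd, Fin.predAbove_succAbove]
            exact hw
        · rw [updWall_inr] at hw
          obtain ⟨hw1, hw2⟩ := hw
          have hj0 : j = 0 := Fin.ext hw2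
          subst hj0
          refine ⟨Sum.inr (a.succAbove 0), ?_, ?_⟩
          · have hk := key (Sum.inr x') (Sum.inr 0)
            rw [hφr, hφr, hπr, hπr] at hk
            exact hk.2 hz
          · rw [updWall_inr, val_succAbove]
            refine ⟨hw1, ?_⟩
            have := a.2
            rcases haj with ⟨hc, ha⟩ | ⟨hc, ha⟩ <;> split_ifs with h0 <;>
              simp only [Fin.val_zero] at h0 ⊢ <;> omega

/-- **Duplicated source: an edge into the new target from either copy gives the same update**, and so
does opening both. [cite: IkhlefPonsaing2012, Lemma 3.3] -/
theorem colUpdate_cpInsDup_open_eq (c : ℤ) (a : Fin (n + 2)) (j₀ : Fin (n + 1)) {Q : ColPattern n}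
    (hQ : Q.1 j₀ j₀ = true) (J : Finset (Fin (n + 2) × Fin (n + 2))) :
    colUpdate (n + 1) c (cpInsDup j₀ Q) (idxEdgeFn (insert (j₀.succ, a) J)) =
        colUpdate (n + 1) c (cpInsDup j₀ Q) (idxEdgeFn (insert (j₀.castSucc, a) J)) ∧
      colUpdate (n + 1) c (cpInsDup j₀ Q) (idxEdgeFn (insert (j₀.castSucc, a) (insert (j₀.succ, a) J))) =
        colUpdate (n + 1) c (cpInsDup j₀ Q) (idxEdgeFn (insert (j₀.castSucc, a) J)) := by
  classical
  have h₁ : (cpInsDup j₀ Q).1 j₀.succ j₀.castSucc = true := by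
    rw [cpInsDup_fst, predAbove_castSucc_self', predAbove_succ_self']; exact hQ
  have h₂ : (cpInsDup j₀ Q).1 j₀.castSucc j₀.succ = true := by
    rw [cpInsDup_fst, predAbove_castSucc_self', predAbove_succ_self']; exact hQ
  refine ⟨colUpdate_insert_of_rel c _ h₁ h₂ a J, ?_⟩
  rw [colUpdate_insert_insert_of_rel c _ h₂ h₁ a J]
  exact colUpdate_insert_of_rel c _ h₁ h₂ a J

end InsTgtUpdate

end Literature.Probability.Percolation
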